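import Mathlib
import HarnessLib
import Summits.ABC.ABC.Theses.CongruentialReceptacle

/-!
# Lemmas for `TameLocalReceptacleResidueFree` (crux `ReceptacleIdentity`, stmt-ABC-1813; typed face
# `TameLocalReceptacle`, stmt-ABC-14354)

Elementary bookkeeping used by the three-triple certificate of
`Summits/ABC/ABC/Theorems/ReceptacleIdentity/Negative/TameLocalReceptacleResidueFree.lean`
(crux disprover `refuter-cdisprove-stmt-ABC-1813-0`, 2026-08-16):

* `pow_four_mod_three`, `pow_four_mod_five`, `pow_four_mod_three_ne_two`, `pow_four_mod_five_le_one` —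
  fourth powers modulo `3` and `5`;
* `exists_prime_not_dvd` — four Bertrand primes above `n₀` cannot all divide a positive `y < n₀⁴/2`;
* `fourth_root_bounds` — `n₀ = ⌊⌊√(2y)⌋^{1/2}⌋ + 1` has `2y < n₀⁴ ≤ 32y`;
* `sum_primeFactors_triple`, `sum_primeFactors_mul_coprime`, `sum_primeFactors_prime_pow`,
  `sum_primeFactors_fifteen` — splitting a residue-free table sum `Σ_{p ∣ abc} t(p; v_p a, v_p b, v_p c)`
  over coprime factors;
* `abs_tableSum_le` — the upper window bounds a table sum by a table-independent quantity.
-/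

set_option linter.dupNamespace false

namespace Summit.ABC.ABC.Theorems.ReceptacleIdentity.Negative

open Literature.NumberTheory.DiophantineGeometry

/-! ### Arithmetic helpers -/

/-- Fourth powers of integers prime to `3` are `≡ 1 (mod 3)`. [folklore] -/
theorem pow_four_mod_three {r : ℕ} (h : ¬ 3 ∣ r) : r ^ 4 % 3 = 1 := by
  rw [Nat.pow_mod]
  have h3 : r % 3 < 3 := Nat.mod_lt _ (by norm_num)
  interval_cases hr : r % 3 <;> omega

/-- Fourth powers of integers prime to `5` are `≡ 1 (mod 5)`. [folklore] -/
theorem pow_four_mod_five {r : ℕ} (h : ¬ 5 ∣ r) : r ^ 4 % 5 = 1 := by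
  rw [Nat.pow_mod]
  have h5 : r % 5 < 5 := Nat.mod_lt _ (by norm_num)
  interval_cases hr : r % 5 <;> omega

/-- Fourth powers are `0` or `1` modulo `3`. [folklore] -/
theorem pow_four_mod_three_ne_two (s : ℕ) : s ^ 4 % 3 ≠ 2 := by
  rw [Nat.pow_mod]
  have h3 : s % 3 < 3 := Nat.mod_lt _ (by norm_num)
  interval_cases hs : s % 3 <;> omega

/-- Fourth powers are `0` or `1` modulo `5`. [folklore] -/
theorem pow_four_mod_five_le_one (s : ℕ) : s ^ 4 % 5 ≤ 1 := by
  rw [Nat.pow_mod]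
  have h5 : s % 5 < 5 := Nat.mod_lt _ (by norm_num)
  interval_cases hs : s % 5 <;> omega

/-- Among the primes of four consecutive Bertrand intervals above `n₀`, one does not divide a positive
`y < n₀⁴ / 2`: four distinct primes `> n₀` dividing `y` would force `n₀⁴ < y`. [folklore] -/
theorem exists_prime_not_dvd {y n₀ : ℕ} (hy : 0 < y) (hn : 2 * y < n₀ ^ 4) (hn0 : n₀ ≠ 0) :
    ∃ s : ℕ, s.Prime ∧ n₀ < s ∧ s ≤ 16 * n₀ ∧ ¬ s ∣ y := by
  obtain ⟨s₁, hs₁, h₁l, h₁u⟩ := Nat.exists_prime_lt_and_le_two_mul n₀ hn0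
  obtain ⟨s₂, hs₂, h₂l, h₂u⟩ := Nat.exists_prime_lt_and_le_two_mul (2 * n₀) (by omega)
  obtain ⟨s₃, hs₃, h₃l, h₃u⟩ := Nat.exists_prime_lt_and_le_two_mul (4 * n₀) (by omega)
  obtain ⟨s₄, hs₄, h₄l, h₄u⟩ := Nat.exists_prime_lt_and_le_two_mul (8 * n₀) (by omega)
  by_cases d₁ : s₁ ∣ y
  swap; · exact ⟨s₁, hs₁, h₁l, by omega, d₁⟩
  by_cases d₂ : s₂ ∣ y
  swap; · exact ⟨s₂, hs₂, by omega, by omega, d₂⟩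
  by_cases d₃ : s₃ ∣ y
  swap; · exact ⟨s₃, hs₃, by omega, by omega, d₃⟩
  refine ⟨s₄, hs₄, by omega, by omega, fun d₄ => ?_⟩
  -- the four primes are distinct, hence their product divides y
  have c₁₂ : Nat.Coprime s₁ s₂ := (Nat.coprime_primes hs₁ hs₂).mpr (by omega)
  have c₁₃ : Nat.Coprime s₁ s₃ := (Nat.coprime_primes hs₁ hs₃).mpr (by omega)
  have c₁₄ : Nat.Coprime s₁ s₄ := (Nat.coprime_primes hs₁ hs₄).mpr (by omega)
  have c₂₃ : Nat.Coprime s₂ s₃ := (Nat.coprime_primes hs₂ hs₃).mpr (by omega)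
  have c₂₄ : Nat.Coprime s₂ s₄ := (Nat.coprime_primes hs₂ hs₄).mpr (by omega)
  have c₃₄ : Nat.Coprime s₃ s₄ := (Nat.coprime_primes hs₃ hs₄).mpr (by omega)
  have h12 : s₁ * s₂ ∣ y := Nat.Coprime.mul_dvd_of_dvd_of_dvd c₁₂ d₁ d₂
  have c12_3 : Nat.Coprime (s₁ * s₂) s₃ := Nat.Coprime.mul_left c₁₃ c₂₃
  have h123 : s₁ * s₂ * s₃ ∣ y := Nat.Coprime.mul_dvd_of_dvd_of_dvd c12_3 h12 d₃
  have c123_4 : Nat.Coprime (s₁ * s₂ * s₃) s₄ := Nat.Coprime.mul_left (Nat.Coprime.mul_left c₁₄ c₂₄) c₃₄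
  have h1234 : s₁ * s₂ * s₃ * s₄ ∣ y := Nat.Coprime.mul_dvd_of_dvd_of_dvd c123_4 h123 d₄
  have hle : s₁ * s₂ * s₃ * s₄ ≤ y := Nat.le_of_dvd hy h1234
  have hgt : n₀ ^ 4 < s₁ * s₂ * s₃ * s₄ := by
    have e : n₀ ^ 4 = n₀ * n₀ * n₀ * n₀ := by ring
    rw [e]
    have a1 : n₀ * n₀ < s₁ * s₂ := Nat.mul_lt_mul'' h₁l (by omega)
    have a2 : n₀ * n₀ * n₀ < s₁ * s₂ * s₃ := Nat.mul_lt_mul'' a1 (by omega)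
    exact Nat.mul_lt_mul'' a2 (by omega)
  omega

/-- `n ↦ ⌊⌊√(2y)⌋^{1/2}⌋ + 1` is a fourth root of `2y` rounded up: `2y < n₀⁴` and, for `y ≥ 1`,
`n₀⁴ ≤ 32 y`. [folklore] -/
theorem fourth_root_bounds {y : ℕ} (hy : 0 < y) :
    2 * y < (Nat.sqrt (Nat.sqrt (2 * y)) + 1) ^ 4 ∧
      (Nat.sqrt (Nat.sqrt (2 * y)) + 1) ^ 4 ≤ 32 * y := by
  set m := Nat.sqrt (2 * y) with hm
  set a := Nat.sqrt m with ha
  have h1 : 2 * y < (m + 1) ^ 2 := Nat.lt_succ_sqrt' (2 * y)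
  have h2 : m < (a + 1) ^ 2 := Nat.lt_succ_sqrt' m
  have h3 : a ^ 2 ≤ m := Nat.sqrt_le' m
  have h4 : m ^ 2 ≤ 2 * y := Nat.sqrt_le' (2 * y)
  have ha1 : 1 ≤ a := by
    rw [ha, Nat.le_sqrt, hm, one_mul, Nat.le_sqrt]
    omega
  constructor
  · calc 2 * y < (m + 1) ^ 2 := h1
      _ ≤ ((a + 1) ^ 2) ^ 2 := Nat.pow_le_pow_left (by omega) 2
      _ = (a + 1) ^ 4 := by ring
  · have h5 : a + 1 ≤ 2 * a := by omega
    calc (a + 1) ^ 4 ≤ (2 * a) ^ 4 := Nat.pow_le_pow_left h5 4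
      _ = 16 * (a ^ 2) ^ 2 := by ring
      _ ≤ 16 * m ^ 2 := by gcongr
      _ ≤ 16 * (2 * y) := by gcongr
      _ = 32 * y := by ring

/-! ### Splitting a table sum over the prime support of a coprime triple -/

/-- For pairwise coprime positive `a, b, c`, a sum over the primes of `abc` of a function of
`(p, v_p a, v_p b, v_p c)` splits into the three one-variable sums. [folklore] -/
theorem sum_primeFactors_triple (f : ℕ → ℕ → ℕ → ℕ → ℤ) {a b c : ℕ} (ha : 0 < a) (hb : 0 < b)
    (hc : 0 < c) (hab : Nat.Coprime a b) (hac : Nat.Coprime a c) (hbc : Nat.Coprime b c) :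
    ∑ p ∈ (a * b * c).primeFactors, f p (a.factorization p) (b.factorization p) (c.factorization p)
      = ∑ p ∈ a.primeFactors, f p (a.factorization p) 0 0
        + ∑ p ∈ b.primeFactors, f p 0 (b.factorization p) 0
        + ∑ p ∈ c.primeFactors, f p 0 0 (c.factorization p) := by
  -- zero valuations off the support
  have z : ∀ {m n : ℕ} (_ : Nat.Coprime m n) {p : ℕ} (_ : p ∈ m.primeFactors), n.factorization p = 0 := by
    intro m n hmn p hp
    refine Nat.factorization_eq_zero_of_not_dvd fun h => ?_
    have pp := Nat.prime_of_mem_primeFactors hp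
    have hg : p ∣ Nat.gcd m n := Nat.dvd_gcd (Nat.dvd_of_mem_primeFactors hp) h
    rw [hmn.gcd_eq_one] at hg
    exact pp.one_lt.ne' (Nat.dvd_one.mp hg)
  rw [Nat.primeFactors_mul (Nat.mul_pos ha hb).ne' hc.ne', Nat.primeFactors_mul ha.ne' hb.ne',
    Finset.sum_union (Finset.disjoint_union_left.mpr ⟨hac.disjoint_primeFactors, hbc.disjoint_primeFactors⟩),
    Finset.sum_union hab.disjoint_primeFactors]
  congr 1
  · congr 1
    · exact Finset.sum_congr rfl fun p hp => by rw [z hab hp, z hac hp]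
    · exact Finset.sum_congr rfl fun p hp => by rw [z hab.symm hp, z hbc hp]
  · exact Finset.sum_congr rfl fun p hp => by rw [z hac.symm hp, z hbc.symm hp]

/-- Splitting a one-variable table sum over a coprime product. [folklore] -/
theorem sum_primeFactors_mul_coprime (g : ℕ → ℕ → ℤ) {m n : ℕ} (hm : 0 < m) (hn : 0 < n)
    (hmn : Nat.Coprime m n) :
    ∑ p ∈ (m * n).primeFactors, g p ((m * n).factorization p)
      = ∑ p ∈ m.primeFactors, g p (m.factorization p) + ∑ p ∈ n.primeFactors, g p (n.factorization p) := by
  rw [Nat.primeFactors_mul hm.ne' hn.ne', Finset.sum_union hmn.disjoint_primeFactors]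
  congr 1
  · refine Finset.sum_congr rfl fun p hp => ?_
    have hn0 : n.factorization p = 0 := by
      refine Nat.factorization_eq_zero_of_not_dvd fun h => ?_
      have pp := Nat.prime_of_mem_primeFactors hp
      have hg : p ∣ Nat.gcd m n := Nat.dvd_gcd (Nat.dvd_of_mem_primeFactors hp) h
      rw [hmn.gcd_eq_one] at hg
      exact pp.one_lt.ne' (Nat.dvd_one.mp hg)
    rw [Nat.factorization_mul hm.ne' hn.ne', Finsupp.add_apply, hn0, add_zero]
  · refine Finset.sum_congr rfl fun p hp => ?_
    have hm0 : m.factorization p = 0 := by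
      refine Nat.factorization_eq_zero_of_not_dvd fun h => ?_
      have pp := Nat.prime_of_mem_primeFactors hp
      have hg : p ∣ Nat.gcd m n := Nat.dvd_gcd h (Nat.dvd_of_mem_primeFactors hp)
      rw [hmn.gcd_eq_one] at hg
      exact pp.one_lt.ne' (Nat.dvd_one.mp hg)
    rw [Nat.factorization_mul hm.ne' hn.ne', Finsupp.add_apply, hm0, zero_add]

/-- A one-variable table sum over the primes of a prime power `p^k` (`k ≥ 1`) is the single term
`g p k`. [folklore] -/
theorem sum_primeFactors_prime_pow (g : ℕ → ℕ → ℤ) {p k : ℕ} (hp : p.Prime) (hk : k ≠ 0) :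
    ∑ q ∈ (p ^ k).primeFactors, g q ((p ^ k).factorization q) = g p k := by
  rw [Nat.primeFactors_prime_pow hk hp, Finset.sum_singleton, Nat.Prime.factorization_pow hp,
    Finsupp.single_eq_same]

/-- The table sum over the primes of `15 = 3 · 5` in the third slot. [folklore] -/
theorem sum_primeFactors_fifteen (g : ℕ → ℕ → ℤ) :
    ∑ q ∈ (15 : ℕ).primeFactors, g q ((15 : ℕ).factorization q) = g 3 1 + g 5 1 := by
  have e : (15 : ℕ) = 3 ^ 1 * 5 ^ 1 := by norm_num
  have hc : Nat.Coprime (3 ^ 1) (5 ^ 1) := by decide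
  rw [e, sum_primeFactors_mul_coprime g (by norm_num) (by norm_num) hc,
    sum_primeFactors_prime_pow g Nat.prime_three one_ne_zero,
    sum_primeFactors_prime_pow g (by norm_num) one_ne_zero]

/-! ### Window bound for a table sum -/

/-- The upper window bounds a table sum over the primes of `abc` by a table-independent quantity.
[folklore] -/
theorem abs_tableSum_le {t : ℕ → ℕ → ℕ → ℕ → ℤ} {K : ℝ}
    (hKt : ∀ p i j k : ℕ, p.Prime → |(t p i j k : ℝ)| ≤ K * (((i + j + k : ℕ) : ℝ) + 1) * Real.log p)
    (a b c : ℕ) :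
    |((∑ p ∈ (a * b * c).primeFactors,
        t p (a.factorization p) (b.factorization p) (c.factorization p) : ℤ) : ℝ)| ≤
      ∑ p ∈ (a * b * c).primeFactors,
        K * (((a.factorization p + b.factorization p + c.factorization p : ℕ) : ℝ) + 1) * Real.log p := by
  push_cast
  refine (Finset.abs_sum_le_sum_abs _ _).trans (Finset.sum_le_sum fun p hp => ?_)
  have h := hKt p (a.factorization p) (b.factorization p) (c.factorization p)
    (Nat.prime_of_mem_primeFactors hp)
  push_cast at h
  exact h

end Summit.ABC.ABC.Theorems.ReceptacleIdentity.Negative
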